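import Mathlib
import HarnessLib
import Literature.Analysis.FluidPDE.NSLocalLerayBackwardUniqueness
import Literature.Analysis.FluidPDE.CurlFreeLiouville
import Summits.NavierStokesRegularity.NavierStokesRegularity.Theorems.LocalSineTubeDoorProfileAlignedWindowRigidityAncient
import Summits.NavierStokesRegularity.NavierStokesRegularity.Theorems.PoloidalWindowDoorPoloidalWindowRigidityFlat
import Summits.NavierStokesRegularity.NavierStokesRegularity.Theorems.PoloidalWindowDoorPoloidalWindowRigidityOneSlice

/-!
# Route `PoloidalWindowDoor`, crux `PoloidalWindowRigidity` (K2, stmt-NavierStokesRegularity-19708) — ANALYTIC GLUE: the degenerate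
# alternatives of conjecture LRC′ on an OPEN SET of one slice already settle the profile

Cell ns-regularity-ideate, seat ns-poloidal-K2-p1 gen 3 (K2 lead; helper `--supports` the crux).  Conjecture LRC′ (seat memo K2P1-LOCAL-NOTES
§10, line proposal «lrc-jet») is LOCAL: on an open set where the vorticity does not vanish and the Clebsch slope is not `0` or `1`, the
vorticity has a horizontal Killing symmetry.  Its complement consists of three degenerate alternatives ON AN OPEN SET of a slice: the vorticity
vanishes there, or the slice is flat there in a horizontal direction (`Λ ≡ 0`), or vertically rigid there (`Λ ≡ 1`).  Slices of the route's
Type-I class are real-analytic (tree `analyticOnNhd_slice`), so each degenerate alternative propagates from the open set to the whole slice by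
the identity theorem and meets a ONE-SLICE stratum theorem of the tree:

* `nonflatLiouville_of_curl_eq_zero_on_open` — `curl v(s) = 0` on a non-empty open set ⇒ `curl v(s) ≡ 0` (tree
  `curl_eq_zero_of_eqOn_open`) ⇒ the bounded divergence-free slice is constant (tree `eq_of_curl_eq_zero_of_isDivFree_of_bounded`) ⇒
  translation-invariant ⇒ nsreg-p6 `eq_zero_of_translate_eq_slice`;
* `nonflatLiouville_of_flat_on_open` — `⟪∂ₐv(s), e₃⟫ = 0` on a non-empty open set for one horizontal `a ≠ 0` ⇒ everywhere (identity theorem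
  for the analytic scalar `y ↦ ⟪Dv(s)(y)[a], e₃⟫`) ⇒ nsreg-p6 `nonflatLiouville_of_flat_slice`;
* `nonflatLiouville_of_vertRigid_on_open` — `∂₃v(s)_h = 0` on a non-empty open set ⇒ everywhere ⇒ nsreg-p6 `nonflatLiouville_of_vertRigid_slice`.

WHAT THIS IS NOT: not a claim about Navier–Stokes regularity, not LRC′ and not the residue — bookkeeping (stub L3 of the proposed line). [folklore]
-/

noncomputable section

-- the summit and its single sub-problem share the name (CONVENTIONS §1), as in every Theorems file
set_option linter.dupNamespace false

namespace Summit.NavierStokesRegularity.NavierStokesRegularity.Theorems.PoloidalWindowDoorPoloidalWindowRigidityDegenerateOpenSet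

open Set Function Filter Topology InnerProductSpace
open scoped RealInnerProductSpace InnerProductSpace
open Literature.Analysis Literature.Analysis.FluidPDE
open Summit.NavierStokesRegularity.NavierStokesRegularity.Theorems.LocalSineTubeDoorProfileAlignedWindowRigidityAncient
open Summit.NavierStokesRegularity.NavierStokesRegularity.Theorems.PoloidalWindowDoorPoloidalWindowRigidityFlat
open Summit.NavierStokesRegularity.NavierStokesRegularity.Theorems.PoloidalWindowDoorPoloidalWindowRigidityOneSlice

variable {C : ℝ} {v : ℝ → EuclideanSpace ℝ (Fin 3) → EuclideanSpace ℝ (Fin 3)}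

/-- **Identity theorem for a directional derivative paired with a vector.**  For a real-analytic field `V` on `ℝ³` and vectors
`a, b`, if `⟪DV(y)[a], b⟫ = 0` on a non-empty open set then it vanishes everywhere. [folklore] -/
theorem inner_fderiv_apply_eq_zero_of_eqOn_open {V : EuclideanSpace ℝ (Fin 3) → EuclideanSpace ℝ (Fin 3)}
    (hV : AnalyticOnNhd ℝ V univ) {S : Set (EuclideanSpace ℝ (Fin 3))} (hS : IsOpen S) (hne : S.Nonempty)
    (a b : EuclideanSpace ℝ (Fin 3)) (h : ∀ y ∈ S, ⟪fderiv ℝ V y a, b⟫_ℝ = 0) (y : EuclideanSpace ℝ (Fin 3)) :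
    ⟪fderiv ℝ V y a, b⟫_ℝ = 0 := by
  -- the scalar `y ↦ ⟪DV(y)[a], b⟫ = ⟪b, DV(y)[a]⟫` is a continuous linear functional of the analytic map `y ↦ DV(y)`
  set Φ : (EuclideanSpace ℝ (Fin 3) →L[ℝ] EuclideanSpace ℝ (Fin 3)) →L[ℝ] ℝ :=
    (innerSL ℝ b).comp (ContinuousLinearMap.apply ℝ (EuclideanSpace ℝ (Fin 3)) a) with hΦ
  have hΦan : AnalyticOnNhd ℝ (fun y => Φ (fderiv ℝ V y)) univ := Φ.comp_analyticOnNhd hV.fderiv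
  have hΦeq : ∀ z, Φ (fderiv ℝ V z) = ⟪fderiv ℝ V z a, b⟫_ℝ := fun z => by
    simp only [hΦ, ContinuousLinearMap.comp_apply, ContinuousLinearMap.apply_apply, innerSL_apply_apply]
    exact real_inner_comm _ _
  obtain ⟨y₀, hy₀⟩ := hne
  have hev : (fun y => Φ (fderiv ℝ V y)) =ᶠ[𝓝 y₀] 0 := by
    filter_upwards [hS.mem_nhds hy₀] with z hz
    rw [hΦeq z, h z hz, Pi.zero_apply]
  have hzero := hΦan.eqOn_zero_of_preconnected_of_eventuallyEq_zero isPreconnected_univ (mem_univ y₀) hev (mem_univ y)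
  rw [← hΦeq y]
  exact hzero

/-- **Irrotational on an open set of one slice ⇒ not backward-singular.**  If a slice `v(s)`, `s < 0`, of a profile of the route's
Type-I class has `curl v(s) = 0` on a non-empty open set, then `(0,0)` is not a backward singular point (the analytic vorticity slice
vanishes identically, the bounded divergence-free slice is constant, and a translation-invariant slice forces `v ≡ 0`). -/
theorem nonflatLiouville_of_curl_eq_zero_on_open (hrate : HasTypeITimeDecay C v)
    (hcont : ContinuousOn (uncurry v) (Iio (0 : ℝ) ×ˢ univ))
    (hmild : ∀ s t : ℝ, s < t → t < 0 → ∀ x,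
      v t x = UnboundedOperators.heatExtension (v s) (t - s) x - oseenDuhamel 1 s v v t x)
    (hdiv : ∀ t < 0, VectorCalculus.IsDivFree (v t)) {s : ℝ} (hs : s < 0)
    {S : Set (EuclideanSpace ℝ (Fin 3))} (hS : IsOpen S) (hne : S.Nonempty) (h : ∀ y ∈ S, curl (v s) y = 0) :
    ¬ IsBackwardSingularPoint v 0 := by
  have hbdd := bdd_of_hasTypeITimeDecay hrate
  have hA : AnalyticOnNhd ℝ (v s) univ := analyticOnNhd_slice hcont hbdd hmild hs
  have hcurl : ∀ y, curl (v s) y = 0 := curl_eq_zero_of_eqOn_open hA hS hne h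
  have hconst : ∀ x y, v s x = v s y :=
    eq_of_curl_eq_zero_of_isDivFree_of_bounded hA.contDiff hcurl (hdiv s hs) (fun x => hrate s hs x)
  have he : (EuclideanSpace.single 2 (1 : ℝ) : EuclideanSpace ℝ (Fin 3)) ≠ 0 := by
    intro h0
    have := congrArg (fun w : EuclideanSpace ℝ (Fin 3) => w 2) h0
    simp at this
  have hinv : ∀ (y : EuclideanSpace ℝ (Fin 3)) (l : ℝ), v s (y + l • EuclideanSpace.single 2 (1 : ℝ)) = v s y :=
    fun y l => hconst _ _
  exact not_backwardSingular_of_zero (eq_zero_of_translate_eq_slice hrate hcont hmild hdiv hs he hinv)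

/-- **Flat in a horizontal direction on an open set of one slice ⇒ not backward-singular.**  If a poloidal slice `v(s)` of a profile
of the class satisfies `⟪∂ₐv(s)(y), e₃⟫ = 0` on a non-empty open set for some horizontal `a ≠ 0`, then it does so everywhere (identity
theorem) and nsreg-p6's flat-slice theorem gives `v ≡ 0`. -/
theorem nonflatLiouville_of_flat_on_open (hrate : HasTypeITimeDecay C v)
    (hcont : ContinuousOn (uncurry v) (Iio (0 : ℝ) ×ˢ univ))
    (hmild : ∀ s t : ℝ, s < t → t < 0 → ∀ x,
      v t x = UnboundedOperators.heatExtension (v s) (t - s) x - oseenDuhamel 1 s v v t x)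
    (hdiv : ∀ t < 0, VectorCalculus.IsDivFree (v t)) {s : ℝ} (hs : s < 0)
    (hpol : ∀ y, ⟪curl (v s) y, EuclideanSpace.single 2 1⟫_ℝ = 0)
    {a : EuclideanSpace ℝ (Fin 3)} (ha : a ≠ 0) (ha3 : ⟪a, EuclideanSpace.single 2 (1 : ℝ)⟫_ℝ = 0)
    {S : Set (EuclideanSpace ℝ (Fin 3))} (hS : IsOpen S) (hne : S.Nonempty)
    (hflat : ∀ y ∈ S, ⟪fderiv ℝ (v s) y a, EuclideanSpace.single 2 1⟫_ℝ = 0) :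
    ¬ IsBackwardSingularPoint v 0 := by
  have hbdd := bdd_of_hasTypeITimeDecay hrate
  have hA : AnalyticOnNhd ℝ (v s) univ := analyticOnNhd_slice hcont hbdd hmild hs
  have hall : ∀ y, ⟪fderiv ℝ (v s) y a, EuclideanSpace.single 2 1⟫_ℝ = 0 :=
    inner_fderiv_apply_eq_zero_of_eqOn_open hA hS hne a _ hflat
  exact nonflatLiouville_of_flat_slice hrate hcont hmild hdiv hs hpol ha ha3 hall

/-- **Vertically rigid on an open set of one slice ⇒ not backward-singular.**  If a slice `v(s)` of a profile of the class has
`∂₃v(s)₀ = ∂₃v(s)₁ = 0` on a non-empty open set, then everywhere (identity theorem for `y ↦ ⟪Dv(s)(y)[e₃], eₖ⟫`, `k = 0,1`) and nsreg-p6's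
vertically-rigid-slice theorem gives `v ≡ 0`. -/
theorem nonflatLiouville_of_vertRigid_on_open (hrate : HasTypeITimeDecay C v)
    (hcont : ContinuousOn (uncurry v) (Iio (0 : ℝ) ×ˢ univ))
    (hmild : ∀ s t : ℝ, s < t → t < 0 → ∀ x,
      v t x = UnboundedOperators.heatExtension (v s) (t - s) x - oseenDuhamel 1 s v v t x)
    (hdiv : ∀ t < 0, VectorCalculus.IsDivFree (v t)) {s : ℝ} (hs : s < 0)
    {S : Set (EuclideanSpace ℝ (Fin 3))} (hS : IsOpen S) (hne : S.Nonempty)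
    (h0 : ∀ y ∈ S, fderiv ℝ (v s) y (EuclideanSpace.single 2 1) 0 = 0)
    (h1 : ∀ y ∈ S, fderiv ℝ (v s) y (EuclideanSpace.single 2 1) 1 = 0) :
    ¬ IsBackwardSingularPoint v 0 := by
  have hbdd := bdd_of_hasTypeITimeDecay hrate
  have hA : AnalyticOnNhd ℝ (v s) univ := analyticOnNhd_slice hcont hbdd hmild hs
  -- coordinates as inner products with the basis vectors
  have hcoord : ∀ (w : EuclideanSpace ℝ (Fin 3)) (k : Fin 3), ⟪w, EuclideanSpace.single k (1 : ℝ)⟫_ℝ = w k := fun w k => by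
    rw [EuclideanSpace.inner_single_right]; simp
  have hk : ∀ k : Fin 3, (∀ y ∈ S, fderiv ℝ (v s) y (EuclideanSpace.single 2 1) k = 0) →
      ∀ y, fderiv ℝ (v s) y (EuclideanSpace.single 2 1) k = 0 := by
    intro k hkS y
    have hS' : ∀ y ∈ S, ⟪fderiv ℝ (v s) y (EuclideanSpace.single 2 1), EuclideanSpace.single k (1 : ℝ)⟫_ℝ = 0 :=
      fun y hy => by rw [hcoord, hkS y hy]
    have h := inner_fderiv_apply_eq_zero_of_eqOn_open hA hS hne (EuclideanSpace.single 2 1) (EuclideanSpace.single k 1) hS' y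
    rwa [hcoord] at h
  exact nonflatLiouville_of_vertRigid_slice hrate hcont hmild hdiv hs (hk 0 h0) (hk 1 h1)

end Summit.NavierStokesRegularity.NavierStokesRegularity.Theorems.PoloidalWindowDoorPoloidalWindowRigidityDegenerateOpenSet

end
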